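import Summits.CriticalPhenomena.SAWScalingLimit.Theorems.AvoidanceLimit.Negative.AvoidanceLimitExponentRigidity

/-!
# Negative knowledge on crux `AvoidanceLimit`, part 8: an open shadow of the crux (strip window)

Support file (refuter / cdisprove lane, cycle 2) for the crux
`Summit.CriticalPhenomena.SAWScalingLimit.Theses.SAWLoopFugacityFlow.AvoidanceLimit`
(stmt-CriticalPhenomena-10649). CONSEQUENCES of the crux that are themselves open and strictly
weaker — recorded so that planners have a cheaper milestone and disprovers a numerically attackable
target:

* `avoidanceLimit_strip_limit` — under the crux, for EVERY endpoint approximation of the square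
  `(bigSq; 2, -2)`, the probability that the critical SAW stays in the closed middle strip
  `[-2,2] × [-1,1]` converges to a number `L ∈ (0, 1)` (`L = Φ'_A(0)^{5/8}` with `Φ'_A(0) ∈ (0,1)` by
  part 6's `restrictionDeriv_lt_one`);
* `avoidanceLimit_strip_window` — hence for some `c > 0` and all small `δ`:
  `c ≤ P_δ(range ⊆ closed strip) ≤ 1 - c`: an `O(1)` confinement cost in a fixed-aspect-ratio strip
  at `x_c` (scale invariance) and a probability bounded below of leaving it. Neither bound is a
  theorem in print for the critical square-lattice SAW. [folklore]
-/

noncomputable section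

open Set Filter Topology MeasureTheory Complex Metric
open UpperHalfPlane (upperHalfPlaneSet isOpen_upperHalfPlaneSet)
open Literature.Probability.RandomPlanarGeometry Literature.Probability.LatticeModels
open Summit.CriticalPhenomena.SAWScalingLimit.Theses.SAWLoopFugacityFlow (AvoidanceLimit)

namespace Summit.CriticalPhenomena.SAWScalingLimit.Theorems.AvoidanceLimit.Negative

/-- **Strip window**: `AvoidanceLimit` gives the strip-in-square avoidance probabilities a limit in
`(0, 1)`, for EVERY endpoint approximation of `(bigSq; 2, -2)`. [folklore] -/
theorem avoidanceLimit_strip_limit (h : AvoidanceLimit) {a b : ℝ → Site 2}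
    (hab : SAW.IsEndpointApprox bigSq a b) :
    ∃ L : ℝ, 0 < L ∧ L < 1 ∧
      Tendsto (fun δ => ((SAW.law bigSq.carrier δ (a δ) (b δ)).map (fun γ => γ.curve))
        (CurveClass.rangeSubset (closure flatRect.carrier))) (𝓝[>] 0) (𝓝 (ENNReal.ofReal L)) := by
  obtain ⟨φ, hφ⟩ := MarkedDomain.exists_isChordalUniformizing_holds bigSq
  have hball : ∃ ε : ℝ, 0 < ε ∧
      flatRect.carrier ∩ Metric.ball (bigSq.pt 0) ε = bigSq.carrier ∩ Metric.ball (bigSq.pt 0) ε ∧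
      flatRect.carrier ∩ Metric.ball (bigSq.pt 1) ε = bigSq.carrier ∩ Metric.ball (bigSq.pt 1) ε := by
    refine ⟨1, one_pos, ?_, ?_⟩
    · rw [bigSq_pt_zero]; exact flatRect_ball_agree 2 (by simp)
    · rw [bigSq_pt_one]; exact flatRect_ball_agree (-2) (by simp)
  have hpt0 : flatRect.pt 0 = bigSq.pt 0 := by rw [flatRect_pt_zero, bigSq_pt_zero]
  have hpt1 : flatRect.pt 1 = bigSq.pt 1 := by rw [flatRect_pt_one, bigSq_pt_one]
  set A : Set ℂ := φ.pullbackHull flatRect with hAdef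
  have hstar : IsStarHull A :=
    IsStarHull.pullbackHull JordanDomain.isSimplyConnected_holds hφ isHullSubdomain_flatRect
  obtain ⟨Φ, hΦ, -⟩ := IsStarHull.existsUnique_isRestrictionMap_holds hstar
  obtain ⟨d, hd0, -, hd⟩ := IsStarHull.exists_hasRestrictionDeriv_holds hstar hΦ
  have hd1 : d < 1 := restrictionDeriv_lt_one hstar hΦ hd (pullbackHull_flatRect_inter_nonempty φ)
  refine ⟨d ^ ((5 : ℝ) / 8), Real.rpow_pos_of_pos hd0 _,
    Real.rpow_lt_one hd0.le hd1 (by norm_num), ?_⟩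
  exact h bigSq flatRect a b hab flatRect_subset hpt0 hpt1 hball φ hφ A rfl Φ d hΦ hd

/-- **Strip confinement is non-degenerate under the crux**: for some `c > 0` and all small `δ`,
`c ≤ P_δ(range ⊆ closed strip) ≤ 1 - c`. [folklore] -/
theorem avoidanceLimit_strip_window (h : AvoidanceLimit) {a b : ℝ → Site 2}
    (hab : SAW.IsEndpointApprox bigSq a b) :
    ∃ c : ℝ, 0 < c ∧ ∀ᶠ δ in 𝓝[>] 0,
      ENNReal.ofReal c ≤ ((SAW.law bigSq.carrier δ (a δ) (b δ)).map (fun γ => γ.curve))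
        (CurveClass.rangeSubset (closure flatRect.carrier)) ∧
      ((SAW.law bigSq.carrier δ (a δ) (b δ)).map (fun γ => γ.curve))
        (CurveClass.rangeSubset (closure flatRect.carrier)) ≤ ENNReal.ofReal (1 - c) := by
  obtain ⟨L, hL0, hL1, hT⟩ := avoidanceLimit_strip_limit h hab
  set c : ℝ := min (L / 2) ((1 - L) / 2) with hc
  have hc0 : 0 < c := lt_min (by linarith) (by linarith)
  have hcL : c < L := lt_of_le_of_lt (min_le_left _ _) (by linarith)
  have hLc : L < 1 - c := by
    have : c ≤ (1 - L) / 2 := min_le_right _ _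
    linarith
  refine ⟨c, hc0, ?_⟩
  have h1 : ∀ᶠ δ in 𝓝[>] 0, ENNReal.ofReal c < ((SAW.law bigSq.carrier δ (a δ) (b δ)).map
      (fun γ => γ.curve)) (CurveClass.rangeSubset (closure flatRect.carrier)) :=
    (tendsto_order.1 hT).1 _ ((ENNReal.ofReal_lt_ofReal_iff hL0).2 hcL)
  have h2 : ∀ᶠ δ in 𝓝[>] 0, ((SAW.law bigSq.carrier δ (a δ) (b δ)).map
      (fun γ => γ.curve)) (CurveClass.rangeSubset (closure flatRect.carrier)) < ENNReal.ofReal (1 - c) :=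
    (tendsto_order.1 hT).2 _ ((ENNReal.ofReal_lt_ofReal_iff (by linarith)).2 hLc)
  filter_upwards [h1, h2] with δ hδ1 hδ2
  exact ⟨hδ1.le, hδ2.le⟩

end Summit.CriticalPhenomena.SAWScalingLimit.Theorems.AvoidanceLimit.Negative

end
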